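import Summits.AtomisticToContinuum.HydrodynamicLimit.Theorems.SpeedCapSurgeryCappedEulerLimitGronwall
import HarnessLib

/-!
# Route `SpeedCapSurgery`, crux `CappedEulerLimit` (stmt-AtomisticToContinuum-17739), II: the crux from the capped window entropy step

Part II of the landed reduction of line `registered` (part I: `SpeedCapSurgeryCappedEulerLimitGronwall.lean`):

* `CappedEulerLimit_of_cappedWindowStep : (∃ ηw > 0, CappedWindowEntropyStepBelow ηw) → SpeedCapSurgery.CappedEulerLimit`

— statics (`stub_reference`, landed) ∘ time zero (`stub_timeZero`, landed) ∘ capped Gronwall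
(`cappedEntropyPropagation_of_windowStep`, part I, from the hypothesis) ∘ the entropy inequality for the CAPPED laws
(§6 `tendstoHydroFieldsAt_of_klDiv_lawAt`: for ARBITRARY finite initial laws `P_N`, `KL((Φ_N,t)_* P_N ‖ ψ_N)/(N+1) → 0` +
exponential concentration of the probability reference give `TendstoHydroFieldsAt P`, by the landed
`Theorems.tendsto_measure_of_klDiv_div_tendsto_zero` and `Measure.le_map_apply`). The hypothesis is the registered residual
stub `stub_cappedWindowStep` of the line BY ITS STATEMENT; discharging it closes crux stmt-AtomisticToContinuum-17739
(conditional result until then).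

Lead prover-line-stmt-AtomisticToContinuum-17739-0, cycle 1 (`--supports stmt-AtomisticToContinuum-17739`).
-/


noncomputable section

namespace Summit.AtomisticToContinuum.HydrodynamicLimit.Theorems.CappedEulerLimit

open scoped ENNReal NNReal Topology
open MeasureTheory Filter Set InformationTheory
open Literature.Analysis.FluidPDE
open Literature.MathematicalPhysics.KineticTheory
open Summit.AtomisticToContinuum.HydrodynamicLimit.Theses.SpeedCapSurgery
open Summit.AtomisticToContinuum.HydrodynamicLimit.Theorems.KineticWindowGronwallActivityInversion

/-! ## §6 The entropy inequality for the capped laws -/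

/-- **Convergence in probability at time `t` from `o(N)` relative entropy of the pushed-forward law of an
ARBITRARY finite initial family `P_N` w.r.t. a concentrating local Gibbs reference** (the entropy-inequality
step of Yau's method, hard-sphere setting, initial laws not necessarily the local Gibbs laws — here the
CAPPED laws): if the reference laws `ψ_N = localGibbsLaw σ a (u t) (θ t) N Φ_N` are finite and their
empirical fields concentrate exponentially around `(ρ, ρu, E)(t)`, and `KL((Φ_N,t)_* P_N ‖ ψ_N)/(N+1) → 0`,
then the empirical fields of `Φ_N.flow t z`, `z ∼ P_N`, converge in probability (in the sense of
`TendstoHydroFieldsAt P`) to `(ρ, ρu, E)(t)`. Proof: the landed sequence form of the entropy inequality for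
events `Theorems.tendsto_measure_of_klDiv_div_tendsto_zero` (arbitrary sets), and
`P_N{z | Φ_N,t z ∈ A} ≤ ((Φ_N,t)_* P_N)(A)` (`Measure.le_map_apply`, `HardSphereFlow.measurable_flow`).
[cite: Yau1991, §2] [cite: KipnisLandim1999, Ch. 6 §1] -/
theorem tendstoHydroFieldsAt_of_klDiv_lawAt {σ : ℝ} {a : T3 → ℝ}
    {ρ θ : ℝ → T3 → ℝ} {u : ℝ → T3 → V3} {t : ℝ}
    (Φ : (N : ℕ) → HardSphereFlow (Torus.geometry (Fin 3)) (hsDiameter σ N) (N + 1))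
    (P : (N : ℕ) → Measure (Config (N + 1) (Fin 3) T3))
    [hP : ∀ N, IsFiniteMeasure (P N)]
    [hfin : ∀ N, IsFiniteMeasure (localGibbsLaw σ a (u t) (θ t) N (Φ N))]
    (hconc : ∀ χ : T3 → ℝ, Continuous χ → ∀ δ : ℝ, 0 < δ → ∃ C : ℝ, 0 < C ∧ ∀ N : ℕ,
      localGibbsLaw σ a (u t) (θ t) N (Φ N)
          {z | δ < |empiricalDensityField z χ - ∫ x, χ x * ρ t x|} ≤
        ENNReal.ofReal (C * Real.exp (-(C⁻¹ * (N + 1)))) ∧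
      localGibbsLaw σ a (u t) (θ t) N (Φ N)
          {z | δ < ‖empiricalMomentumField z χ - ∫ x, (χ x * ρ t x) • u t x‖} ≤
        ENNReal.ofReal (C * Real.exp (-(C⁻¹ * (N + 1)))) ∧
      localGibbsLaw σ a (u t) (θ t) N (Φ N)
          {z | δ < |empiricalEnergyField z χ -
            ∫ x, χ x * totalEnergyDensity (ρ t x) (u t x) (θ t x)|} ≤
        ENNReal.ofReal (C * Real.exp (-(C⁻¹ * (N + 1)))))
    (hkl : Tendsto (fun N : ℕ => klDiv ((Φ N).lawAt (P N) t)
      (localGibbsLaw σ a (u t) (θ t) N (Φ N)) / ((N : ℝ≥0∞) + 1)) atTop (𝓝 0)) :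
    TendstoHydroFieldsAt P Φ ρ u θ t := by
  intro χ hχ δ hδ
  obtain ⟨C, hC, hN⟩ := hconc χ hχ δ hδ
  -- the laws at time `t` and the transfer inequality along the flow
  set μ : ∀ N : ℕ, Measure (Config (N + 1) (Fin 3) T3) := fun N => (Φ N).lawAt (P N) t with hμ
  have hμfin : ∀ N, IsFiniteMeasure (μ N) := fun N => by
    simp only [hμ, HardSphereFlow.lawAt_eq]
    infer_instance
  have htransfer : ∀ (N : ℕ) (A : Set (Config (N + 1) (Fin 3) T3)),
      P N {z | (Φ N).flow t z ∈ A} ≤ μ N A := fun N A => by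
    simp only [hμ, HardSphereFlow.lawAt_eq]
    exact Measure.le_map_apply ((Φ N).measurable_flow t).aemeasurable A
  have key : ∀ A : ∀ N : ℕ, Set (Config (N + 1) (Fin 3) T3),
      (∀ N : ℕ, localGibbsLaw σ a (u t) (θ t) N (Φ N) (A N) ≤
        ENNReal.ofReal (C * Real.exp (-(C⁻¹ * ((N : ℝ) + 1))))) →
      Tendsto (fun N : ℕ => P N {z | (Φ N).flow t z ∈ A N}) atTop (𝓝 0) := fun A hA => by
    have h := Summit.AtomisticToContinuum.HydrodynamicLimit.Theorems.tendsto_measure_of_klDiv_div_tendsto_zero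
      μ (fun N => localGibbsLaw σ a (u t) (θ t) N (Φ N)) A hC hA hkl
    exact tendsto_of_tendsto_of_tendsto_of_le_of_le tendsto_const_nhds h
      (fun N => zero_le) (fun N => htransfer N (A N))
  refine ⟨?_, ?_, ?_⟩
  · exact key (fun N => {z | δ < |empiricalDensityField z χ - ∫ x, χ x * ρ t x|})
      (fun N => (hN N).1)
  · exact key (fun N => {z | δ < ‖empiricalMomentumField z χ - ∫ x, (χ x * ρ t x) • u t x‖})
      (fun N => (hN N).2.1)
  · exact key (fun N => {z | δ < |empiricalEnergyField z χ -
        ∫ x, χ x * totalEnergyDensity (ρ t x) (u t x) (θ t x)|}) (fun N => (hN N).2.2)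

/-! ## §7 The crux from the capped window step -/

/-- **`CappedEulerLimit` from the capped window entropy step (conditional closure of crux
stmt-AtomisticToContinuum-17739).** Statics (`stub_reference`, landed) ∘ time zero (`stub_timeZero`, landed) ∘
capped Gronwall (`cappedEntropyPropagation_of_windowStep`, from the hypothesis) ∘ entropy inequality for the
capped laws: `η₀ := min ηs ηd`, `σ₀ :=` the minimum of the three profile-wise thresholds; the guard is threaded
to both interfaces, `0 < T` is read off `t ∈ [0,T)`, and the entropy limit at `(t, C)` is converted into
convergence in probability of the fields under the CAPPED laws by `tendstoHydroFieldsAt_of_klDiv_lawAt`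
(`cappedLaw` unfolds to the crux's restricted law definitionally). The hypothesis is the registered residual
stub `stub_cappedWindowStep` of line `registered` BY ITS STATEMENT; discharging it closes the crux.
[cite: Yau1991, §2] [cite: NachtergaeleYau2003, §7.2] -/
theorem CappedEulerLimit_of_cappedWindowStep (hW : ∃ ηw : ℝ, 0 < ηw ∧ CappedWindowEntropyStepBelow ηw) :
    Summit.AtomisticToContinuum.HydrodynamicLimit.Theses.SpeedCapSurgery.CappedEulerLimit := by
  obtain ⟨ηs, hηs, HR⟩ := stub_reference
  obtain ⟨ηd, hηd, HG⟩ := cappedEntropyPropagation_of_windowStep hW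
  refine ⟨min ηs ηd, lt_min hηs hηd, fun a₀ θ₀ u₀ ha hθ hu ha0 hθ0 => ?_⟩
  obtain ⟨σ₁, hσ₁, H₁⟩ := HR a₀ θ₀ u₀ ha hθ hu ha0 hθ0
  obtain ⟨σ₂, hσ₂, H₂⟩ := stub_timeZero a₀ θ₀ u₀ ha hθ hu ha0 hθ0
  obtain ⟨σ₃, hσ₃, H₃⟩ := HG a₀ θ₀ u₀ ha hθ hu ha0 hθ0
  refine ⟨min σ₁ (min σ₂ σ₃), lt_min hσ₁ (lt_min hσ₂ hσ₃), ?_⟩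
  intro σ hσ hσlt T ρ θ u hsol hguard Φ h0 t ht C
  have hσ₁' : σ < σ₁ := hσlt.trans_le (min_le_left _ _)
  have hσ₂' : σ < σ₂ := hσlt.trans_le ((min_le_right _ _).trans (min_le_left _ _))
  have hσ₃' : σ < σ₃ := hσlt.trans_le ((min_le_right _ _).trans (min_le_right _ _))
  have hgs : ∀ s ∈ Ico 0 T, ∀ x, ρ s x * σ ^ 3 < ηs :=
    fun s hs x => (hguard s hs x).trans_le (min_le_left _ _)
  have hgd : ∀ s ∈ Ico 0 T, ∀ x, ρ s x * σ ^ 3 < ηd :=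
    fun s hs x => (hguard s hs x).trans_le (min_le_right _ _)
  have hT : 0 < T := ht.1.trans_lt ht.2
  obtain ⟨hprob, href⟩ := H₁ σ hσ hσ₁' T ρ θ u hsol hgs Φ
  have hfam : ∀ s ∈ Ico 0 T, RefConcentrates σ (ρ s) (θ s) (u s) Φ := href h0
  have hzero := H₂ σ hσ hσ₂' T ρ θ u hsol hT Φ h0
  have hkl := H₃ σ hσ hσ₃' T ρ θ u hsol hgd Φ hprob h0 hzero hfam t ht C
  obtain ⟨hψ, hconc⟩ := hfam t ht
  -- the capped laws are finite (restrictions of probability laws)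
  have hfinP : ∀ N, IsFiniteMeasure (cappedLaw σ a₀ θ₀ u₀ t C N (Φ N)) := fun N => by
    unfold cappedLaw
    infer_instance
  exact tendstoHydroFieldsAt_of_klDiv_lawAt (a := thermoActivity σ (ρ t)) Φ
    (fun N => cappedLaw σ a₀ θ₀ u₀ t C N (Φ N)) hconc hkl

end Summit.AtomisticToContinuum.HydrodynamicLimit.Theorems.CappedEulerLimit

end
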